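import Summits.Ventures.AbcSig.Rows.TemplateC
import Summits.Ventures.AbcSig.Levels.N50
import Summits.Ventures.AbcSig.Levels.N800

/-!
# Venture AbcSig — ROW (REPRODUCTION of [BS04, §5.2]): `xⁿ + yⁿ = 5 z²`

HONEST FRAMING. A row of a COMPUTATION cell (`pub-abcsig`); a CONDITIONAL theorem, no claim on ABC or any summit.
Printed result being reproduced: [BS04, §5.2, pp. 40–41] (Theorem 1.1 for `C = 5`, prime exponents `n ≥ 7`): `ab`
even leads to level `50` ("just two newforms of this level … each has `c₃ = ±1`"), `ab` odd to level `800`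
("14 Galois conjugacy classes"; Prop. 4.3 with `c₃`, `c₁₉`; forms 800,3 (C) and 800,7 (G) by Prop. 4.4; forms
800,1 (A), 800,4 (D), 800,8 (H) by Prop. 4.6). What this file PROVES (kernel-checked), via `row_template`: for every
abstract newform model `M` and every prime `n ≥ 7`,

  `BS04Package M` (CITED: [BS04] Lemma 3.3 = modularity + Cor. 3.1 + Ribet, with (3.1) and Lemma 4.2)
  `→ DataComplete M 50 level50Orbits` and `DataComplete M 800 level800Orbits` (COMPUTED, two engines agree)
  `→ Excludes M 800 o (family C = 5, exponent n, xy odd)` for the five orbits the sieve cannot touch (CITED: our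
     `800.1`, `800.9` = the rational orbits with `c₃ = ∓2`, printed 800,3 (C) / 800,7 (G), Prop. 4.4 — `j`-invariant
     denominators divisible by `5`; our `800.4`, `800.5`, `800.6` = the rational orbits with `c₃ = 0`, CM by `ℚ(√−1)`,
     printed 800,1 (A) / 800,4 (D) / 800,8 (H), Prop. 4.6 as on [BS04, p. 40]; data-matched bijection = the referee's
     S0-3 table in the cell HOME `run/shared/lean/pub/pub-abcsig/`)
  `→` `xⁿ + yⁿ = 5z²` has NO solution in nonzero pairwise coprime integers `(x, y, z)`.

Everything else is the kernel: the sieve certificates of `Levels/N50.lean`, `Levels/N800.lean` (`decide`; the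
`√5`-orbits need `c₁₉`, as printed — no residual exponent remains, the printed `n = 11` survivor of `c₃` dies at `c₁₉`)
and the elementary reductions of `Rows/TemplateC.lean`.
-/

namespace Summit.Ventures.AbcSig

/-- **Row `nn2-A1-B1-C5` (REPRODUCTION of [BS04, Thm. 1.1, C = 5, prime n ≥ 7]).** Conditional on `BS04Package`
(cited), `DataComplete 50` / `DataComplete 800` (computed, two-engine certified) and the cited Prop. 4.4 / 4.6
exclusions of the rational orbits `800.1, 800.9` (`c₃ = ∓2`) and `800.4, 800.5, 800.6` (`c₃ = 0`, CM) for the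
exponent `n`, the equation `xⁿ + yⁿ = 5z²` has no solution in nonzero pairwise coprime integers. -/
theorem row_xn_add_yn_eq_5z2 (M : NewformModel) (hP : M.BS04Package)
    (hD50 : M.DataComplete 50 level50Orbits) (hD800 : M.DataComplete 800 level800Orbits)
    (n : ℕ) (hn : n.Prime) (h7 : 7 ≤ n)
    (hX1 : M.Excludes 800 orbit_800_1 (fun S => S.A = 1 ∧ S.B = 1 ∧ S.C = 5 ∧ S.n = n ∧ ¬ 2 ∣ S.a * S.b))
    (hX4 : M.Excludes 800 orbit_800_4 (fun S => S.A = 1 ∧ S.B = 1 ∧ S.C = 5 ∧ S.n = n ∧ ¬ 2 ∣ S.a * S.b))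
    (hX5 : M.Excludes 800 orbit_800_5 (fun S => S.A = 1 ∧ S.B = 1 ∧ S.C = 5 ∧ S.n = n ∧ ¬ 2 ∣ S.a * S.b))
    (hX6 : M.Excludes 800 orbit_800_6 (fun S => S.A = 1 ∧ S.B = 1 ∧ S.C = 5 ∧ S.n = n ∧ ¬ 2 ∣ S.a * S.b))
    (hX9 : M.Excludes 800 orbit_800_9 (fun S => S.A = 1 ∧ S.B = 1 ∧ S.C = 5 ∧ S.n = n ∧ ¬ 2 ∣ S.a * S.b))
    (a b c : ℤ) : ¬ IsPrimitiveSolution 1 1 5 n a b c := by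
  have h5 : Nat.Prime 5 := by norm_num
  have hnC : ¬ n ∣ 5 := by
    intro h
    rcases (Nat.dvd_prime h5).mp h with h1 | h1
    · exact hn.one_lt.ne' h1
    · omega
  exact row_template 5 (by norm_num) (Nat.prime_iff.mp h5).squarefree (by decide) M hP hD50 hD800 n hn h7 hnC
    (level50_sieve n hn h7 (fun o => M.Excludes 50 o
      (fun S => S.A = 1 ∧ S.B = 1 ∧ S.C = 5 ∧ S.n = n ∧ 2 ∣ S.a * S.b)))
    (level800_sieve n hn h7 (fun o => M.Excludes 800 o
      (fun S => S.A = 1 ∧ S.B = 1 ∧ S.C = 5 ∧ S.n = n ∧ ¬ 2 ∣ S.a * S.b)) hX1 hX4 hX5 hX6 hX9)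
    a b c

end Summit.Ventures.AbcSig
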